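import Literature.Analysis.FluidPDE.CompressibleEulerImplosionGermUniform
import HarnessLib

/-!
# Buckmaster–Cao-Labora–Gómez-Serrano at γ = 5/3: continuity of the `P₀` germ in `r`

The Taylor coefficients `wₙ(r)` of the origin profile (eq. (2.12)) are continuous (indeed
polynomial) functions of `r`; with the uniform majorant of
`CompressibleEulerImplosionGermUniform` the profile `r ↦ 𝒲_r(ζ)` is continuous on
`r ∈ [11/10, 28/25]` for `|ζ| < 1/224`, hence so is the far-field germ `r ↦ (W, Z)_r(ξ)` of the
`P₀` solution at every time `ξ ≤ ξ_A` — the initial data of the shooting argument of §6 depend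
continuously on the parameter.

[cite: BuckmasterCaolaboraGomezserrano2025, Prop. 2.5, §6]
-/

noncomputable section

open Set Filter Topology Finset

namespace Literature.Analysis.FluidPDE

namespace BuckmasterCaolaboraGomezserrano2025

namespace Monatomic

namespace Germ

open OriginSeries

/-- The coefficients `wₙ(r)` are continuous in `r`. [cite: BuckmasterCaolaboraGomezserrano2025, eq. (2.12)] -/
theorem continuous_w {A : ℝ} (hA : A ≠ 0) (n : ℕ) : Continuous fun r : ℝ => w r A n := by
  induction n using Nat.strong_induction_on with
  | _ n ih =>
    rcases n with _ | n
    · simp only [w_zero]; exact continuous_const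
    · have e : (fun r : ℝ => w r A (n + 1)) = fun r => -rest r (w r A) n / lead (w r A) n := by
        funext r; rw [w_succ]; rfl
      rw [e]
      have hlead : (fun r : ℝ => lead (w r A) n) = fun _ => A / 3 * ((n : ℝ) + 1 + (1 - (-1) ^ (n + 1))) := by
        funext r; exact lead_w n
      refine Continuous.div ?_ (by rw [hlead]; exact continuous_const) fun r => lead_w_ne hA n
      refine Continuous.neg ?_
      unfold rest vv dd
      refine ((((continuous_id.sub continuous_const).mul (ih n (by omega)))).add ?_).add ?_
      · refine continuous_finsetSum _ fun k hk => ?_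
        have hk' := mem_range.mp hk
        exact (continuous_const.add (continuous_const.mul (ih (k + 1) (by omega)))).mul
          (continuous_const.mul (ih (n - (k + 1) + 1) (by omega)))
      · refine continuous_const.mul (continuous_finsetSum _ fun k hk => ?_)
        have hk' := mem_range.mp hk
        exact (ih (k + 1) (by omega)).mul (ih (n - k) (by omega))

/-- **Continuity of the profile in `r`** on `[11/10, 28/25]`, for `|ζ| < 1/224`.
[cite: BuckmasterCaolaboraGomezserrano2025, Prop. 2.5] -/
theorem continuousOn_profile {ζ : ℝ} (hζ : |ζ| < 1 / 224) :
    ContinuousOn (fun r : ℝ => profile r 1 ζ) (Icc (11 / 10) (28 / 25)) := by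
  unfold profile
  refine continuousOn_tsum (u := fun n => 6 / 5 * (1 / 2 : ℝ) ^ n)
    (fun n => ((continuous_w one_ne_zero n).mul continuous_const).continuousOn)
    (summable_geometric_two.mul_left _) fun n r hr => ?_
  have h1 : (1 : ℝ) ≤ r := by linarith [hr.1]
  have hζ' : |ζ| < rad r 1 := hζ.trans_le (rad_ge h1 hr.2)
  have h := abs_term_le (r := r) one_ne_zero hζ' n
  rw [Real.norm_eq_abs]
  calc |w r 1 n * ζ ^ n| ≤ K0 r 1 * (1 / 2) ^ n := h
    _ ≤ 6 / 5 * (1 / 2) ^ n := by gcongr; exact K0_le h1 hr.2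

/-- **Continuity of the far-field germ in `r`** at every `ξ ≤ ξ_A`.
[cite: BuckmasterCaolaboraGomezserrano2025, Prop. 2.5, §6] -/
theorem continuousOn_germ {ξ : ℝ} (hξ : ξ ≤ ξA) :
    ContinuousOn (fun r : ℝ => germ r ξ) (Icc (11 / 10) (28 / 25)) := by
  have hx := exp_lt_of_le hξ
  have hpos := Real.exp_pos ξ
  have ha : |Real.exp ξ| < 1 / 224 := by rw [abs_of_pos hpos]; linarith
  have ha' : |(-Real.exp ξ)| < 1 / 224 := by rwa [abs_neg]
  have hW : ContinuousOn (fun r : ℝ => (germ r ξ).1) (Icc (11 / 10) (28 / 25)) := by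
    simp only [germ_fst]
    exact continuousOn_const.mul (continuousOn_profile ha)
  have hZ : ContinuousOn (fun r : ℝ => (germ r ξ).2) (Icc (11 / 10) (28 / 25)) := by
    simp only [germ_snd]
    exact continuousOn_const.mul (continuousOn_profile ha')
  exact hW.prodMk hZ

end Germ

end Monatomic

end BuckmasterCaolaboraGomezserrano2025

end Literature.Analysis.FluidPDE
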